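import Mathlib
import Summits.Ventures.PercRepro2.MixChordNarrowed2
import Summits.Ventures.PercRepro2.MixChordExists

/-!
# Witness classes for the existential (MIX-CHORD) (blind cell PercRepro2, night-1 g19; NIGHT1-G19.md §8)

`WitnessClass`: the root edges along which the mixed chord is a theorem — internal, bridge, the
two edges `{a₃, a₁}` / `{a₃, a₂}`, and the edges from a weight-`1` root cluster to a vertex whose
weight-`1` cluster carries `a₃`.  **`mixChordExists_of_witness`**: (MIX-CHORD, ∃) holds at every
weight vector that has such a root edge; **`HCov_all_of_mixChordExistsNarrowed_all`**: the crux from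
(MIX-CHORD, ∃) assumed only at the vectors with NO witness-class root edge.

Own code; standard axioms.
-/

namespace Summit.Ventures.PercRepro2

open UnionCluster CovForm

namespace Mix

open scoped Classical

section Witness

variable {V : Type*} {E : Type*} [Fintype E] [DecidableEq E] [Fintype V] [DecidableEq V]
  {R : Type*} [Field R] [LinearOrder R] [IsStrictOrderedRing R]

/-- A root edge of a WITNESS class: internal, bridge, `{a₃, a₁}`, `{a₃, a₂}`, or from a weight-`1`
root cluster to a vertex whose weight-`1` cluster carries `a₃`. -/
def WitnessClass (p : E → R) (ends : E → Sym2 V) (a₁ a₂ a₃ : V) (e : E) : Prop :=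
  ClosedClass p ends a₁ a₂ a₃ e ∨ A3Class p ends a₁ a₂ a₃ e

/-- A root edge of a witness class satisfies the mixed chord. -/
theorem mixChord_of_witnessClass {p : E → R} {ends : E → Sym2 V} {o a₁ a₂ a₃ b : V} {e : E}
    (hp : IsProbVec p) (he : e ∈ Chord.rootEdges p ends a₁ a₂)
    (hw : WitnessClass p ends a₁ a₂ a₃ e) :
    p e * Gc (Function.update p e 1) ends o a₁ a₂ a₃ b +
      (1 - p e) * (shrink p ends a₁ a₂ a₃ e * Gc (Function.update p e 0) ends o a₁ a₂ a₃ b) ≤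
        Gc p ends o a₁ a₂ a₃ b := by
  rcases hw with hc | h3
  · rcases hc with ⟨x, y, hxy, ⟨hx, hy⟩ | ⟨hx, hy⟩ | ⟨hx, hy⟩⟩ | hf | hf
    · exact mixChord_internal p hp (Chord.frac_of_mem_rootEdges he) hx hy hxy o a₁ a₂ a₃ b
    · exact mixChord_internal p hp (Chord.frac_of_mem_rootEdges he) hx hy hxy o a₁ a₂ a₃ b
    · exact mixChord_bridge p ends hp hx hy hxy o a₃ b
    · exact mixChord_root_edge p ends o b hp hf
    · exact mixChord_root2_edge p ends o b hp hf
  · exact mixChord_of_a3Class hp he h3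

/-- **(MIX-CHORD, ∃) holds at every `p` with a root edge of a witness class.** -/
theorem mixChordExists_of_witness {p : E → R} {ends : E → Sym2 V} {o a₁ a₂ a₃ b : V}
    (hp : IsProbVec p)
    (h : ∃ e ∈ Chord.rootEdges p ends a₁ a₂, WitnessClass p ends a₁ a₂ a₃ e) :
    MixChordExists p ends o a₁ a₂ a₃ b := fun _ =>
  let ⟨e, he, hw⟩ := h
  ⟨e, he, mixChord_of_witnessClass hp he hw⟩

end Witness

section WitnessAll

variable (R : Type*) [Field R] [LinearOrder R] [IsStrictOrderedRing R]

/-- (MIX-CHORD, ∃) assumed only at the vectors with NO root edge of a witness class. -/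
def MixChordExistsNarrowed_all : Prop :=
  ∀ (V E : Type) [Fintype V] [DecidableEq V] [Fintype E] [DecidableEq E]
    (ends : E → Sym2 V) (p : E → R), IsProbVec p →
    ∀ o a₁ a₂ a₃ b : V, a₁ ≠ a₂ → a₁ ≠ a₃ → a₂ ≠ a₃ → o ≠ a₁ → o ≠ a₂ → o ≠ a₃ → o ≠ b →
      b ≠ a₁ → b ≠ a₂ → b ≠ a₃ →
      (∀ e ∈ Chord.rootEdges p ends a₁ a₂, ¬ WitnessClass p ends a₁ a₂ a₃ e) →
      MixChordExists p ends o a₁ a₂ a₃ b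

/-- **The crux from (MIX-CHORD, ∃) at the vectors without a witness-class root edge.** -/
theorem HCov_all_of_mixChordExistsNarrowed_all (h : MixChordExistsNarrowed_all R) : HCov_all R := by
  refine HCov_all_of_mixChordExists_all R ?_
  intro V E _ _ _ _ ends p hp o a₁ a₂ a₃ b h12 h13 h23 ho1 ho2 ho3 hob hb1 hb2 hb3
  by_cases hw : ∃ e ∈ Chord.rootEdges p ends a₁ a₂, WitnessClass p ends a₁ a₂ a₃ e
  · exact mixChordExists_of_witness hp hw
  · push Not at hw
    exact h V E ends p hp o a₁ a₂ a₃ b h12 h13 h23 ho1 ho2 ho3 hob hb1 hb2 hb3 hw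

end WitnessAll

end Mix

end Summit.Ventures.PercRepro2
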